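import Literature.Analysis.FluidPDE.BoltzmannGradLimitProofs
import HarnessLib

/-!
# Marginals at an adjoined configuration: moving the adjoined particle to the last slot
(Cercignani–Illner–Pulvirenti 1994 §4.3 (3.5); Gallagher–Saint-Raymond–Texier 2013 (4.3.2);
trunk T-KINETIC, topic MathematicalPhysics/KineticTheory; step T5b of the plan for the input (S)
of `bodineau_gallagher_saintRaymond_linear_of_S`.)

The `(s+1)`-particle marginal `f^{(s+1)}` of an `(s+1+m)`-particle function `F`
(`nthMarginal (s+1+m) (s+1) F`) evaluated at an adjoined configuration
`appendParticle Y x v` (the `s` tagged particles `Y` and a partner `(x, v)` as particle `s`)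
integrates `F` over the remaining `m` particles placed AFTER the partner:
`f^{(s+1)}(Y, (x,v)) = ∫ F(Y, (x,v), z_m) dz_m` (`nthMarginal_succ_add_apply`, no hypothesis). In
the flux computations of the BBGKY hierarchy the partner arises as the LAST particle of the big
configuration, `(Y, z_m, (x,v))`; for `F` symmetric under relabellings of the untagged block
`{s, …, s+m}` the two integrands agree (`apply_append_appendParticle_eq_of_restSymmetric`, the
cyclic shift of the untagged block), whence
`f^{(s+1)}(Y, (x,v)) = ∫ F(Y, z_m, (x,v)) dz_m` (`nthMarginal_appendParticle_eq_of_restSymmetric`).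

## References

* C. Cercignani, R. Illner, M. Pulvirenti, *The Mathematical Theory of Dilute Gases*, Springer
  (1994), §4.3 (3.5) (marginals; symmetry in the untagged particles).
* I. Gallagher, L. Saint-Raymond, B. Texier, *From Newton to Boltzmann*, EMS (2013),
  arXiv:1208.5753, (4.3.2).
-/

open MeasureTheory Set Function
open Literature.Analysis.FluidPDE (Config appendParticle nthMarginal marginal)
open Literature.Analysis.FluidPDE

namespace Literature.MathematicalPhysics.KineticTheory

noncomputable section

section Marginal

variable {d : Type*} [Fintype d] {X : Type*}

/-- **The `(s+1)`-marginal of an `(s+1+m)`-particle function, without casts**: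
`f^{(s+1)}(W) = ∫ F(W, z_m) dz_m`. [folklore] -/
theorem nthMarginal_succ_add_apply [MeasureSpace X] [SigmaFinite (volume : Measure X)] {s m : ℕ}
    (F : Config (s + 1 + m) d X → ℝ) (W : Config (s + 1) d X) :
    nthMarginal (s + 1 + m) (s + 1) F W = ∫ zm : Config m d X, F (Fin.append W zm) := by
  haveI : SigmaFinite (volume : Measure (X × EuclideanSpace ℝ d)) := inferInstance
  unfold nthMarginal
  rw [dif_pos (Nat.le_add_right (s + 1) m)]
  unfold marginal
  have hm : s + 1 + m - (s + 1) = m := by omega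
  obtain ⟨e, he, hemp⟩ := exists_castEquiv hm (X × EuclideanSpace ℝ d)
  rw [← hemp.integral_comp' ]
  refine integral_congr_ae (ae_of_all _ fun zm' => ?_)
  beta_reduce
  congr 1
  funext k
  refine Fin.addCases (fun i => ?_) (fun j => ?_) k
  · have h1 : Fin.cast (Nat.add_sub_of_le (Nat.le_add_right (s + 1) m)).symm (Fin.castAdd m i) =
        Fin.castAdd (s + 1 + m - (s + 1)) i := Fin.ext rfl
    rw [h1, Fin.append_left, Fin.append_left]
  · have h2 : Fin.cast (Nat.add_sub_of_le (Nat.le_add_right (s + 1) m)).symm (Fin.natAdd (s + 1) j) =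
        Fin.natAdd (s + 1) (Fin.cast hm.symm j) := Fin.ext rfl
    rw [h2, Fin.append_right, Fin.append_right, he]

/-- The cyclic shift of the untagged block `{s, …, s+m}` which brings the last particle to the
slot `s`: a permutation of `Fin (s + (m + 1))` fixing the tagged block. [folklore] -/
theorem exists_perm_restShift (s m : ℕ) :
    ∃ σ : Equiv.Perm (Fin (s + (m + 1))),
      (∀ i : Fin s, σ (Fin.castAdd (m + 1) i) = Fin.castAdd (m + 1) i) ∧
      σ (Fin.natAdd s 0) = Fin.natAdd s (Fin.last m) ∧
      ∀ j : Fin m, σ (Fin.natAdd s j.succ) = Fin.natAdd s (Fin.castSucc j) := by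
  have h0 : (finRotate (m + 1)).symm 0 = Fin.last m := by
    rw [Equiv.symm_apply_eq]
    exact finRotate_last.symm
  have hs : ∀ j : Fin m, (finRotate (m + 1)).symm j.succ = Fin.castSucc j := by
    intro j
    rw [Equiv.symm_apply_eq]
    refine Fin.ext ?_
    rw [coe_finRotate_of_ne_last (Fin.castSucc_lt_last j).ne]
    simp
  refine ⟨finSumFinEquiv.symm.trans ((Equiv.sumCongr (Equiv.refl (Fin s)) (finRotate (m + 1)).symm).trans finSumFinEquiv),
    fun i => ?_, ?_, fun j => ?_⟩
  · simp
  · simp [h0]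
  · simp [hs j]

omit [Fintype d] in
/-- **Relabelling the adjoined particle**: for `F` symmetric under the relabellings of the
untagged block fixing the tagged particles, `F(Y, (x,v), z_m) = F(Y, z_m, (x,v))`, the two
configurations being read in `Config (s + 1 + m)` (the second through the cast
`s + 1 + m = s + (m + 1)`). [folklore] -/
theorem apply_append_appendParticle_eq_of_restSymmetric {s m : ℕ} {F : Config (s + 1 + m) d X → ℝ}
    (hF : ∀ σ : Equiv.Perm (Fin (s + 1 + m)), (∀ i : Fin s, σ (Fin.cast (by omega) (Fin.castAdd (m + 1) i)) =
      Fin.cast (by omega) (Fin.castAdd (m + 1) i)) → ∀ w : Config (s + 1 + m) d X, F (w ∘ σ) = F w)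
    (Y : Config s d X) (x : X) (v : EuclideanSpace ℝ d) (zm : Config m d X) :
    F (Fin.append (appendParticle Y x v) zm) =
      F (fun k => appendParticle (Fin.append Y zm) x v (Fin.cast (Nat.add_right_comm s 1 m) k)) := by
  obtain ⟨σ, hσl, hσ0, hσs⟩ := exists_perm_restShift s m
  -- transport `σ` to `Fin (s + 1 + m)`
  have hcast : s + (m + 1) = s + 1 + m := by omega
  set σ' : Equiv.Perm (Fin (s + 1 + m)) := (finCongr hcast).symm.trans (σ.trans (finCongr hcast)) with hσ'
  have key : (fun k => appendParticle (Fin.append Y zm) x v (Fin.cast (Nat.add_right_comm s 1 m) k)) ∘ σ' =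
      Fin.append (appendParticle Y x v) zm := by
    funext k
    simp only [Function.comp_apply, hσ', Equiv.trans_apply, finCongr_symm, finCongr_apply]
    -- split `k` along `s + (m + 1)` after casting
    obtain ⟨k', rfl⟩ : ∃ k' : Fin (s + (m + 1)), k = Fin.cast hcast k' := ⟨Fin.cast hcast.symm k, Fin.ext rfl⟩
    have hkk : Fin.cast hcast.symm (Fin.cast hcast k') = k' := Fin.ext rfl
    rw [hkk]
    refine Fin.addCases (fun i => ?_) (fun l => ?_) k'
    · -- tagged particle
      rw [hσl i]
      have e1 : Fin.cast (Nat.add_right_comm s 1 m) (Fin.cast hcast (Fin.castAdd (m + 1) i)) =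
          Fin.castAdd 1 (Fin.castAdd m i) := Fin.ext rfl
      have e2 : Fin.cast hcast (Fin.castAdd (m + 1) i) = Fin.castAdd m (Fin.castAdd 1 i) := Fin.ext rfl
      rw [e1, e2, appendParticle_castAdd, Fin.append_left, Fin.append_left, appendParticle_castAdd]
    · -- untagged particle `l : Fin (m + 1)`: `l = 0` is the partner, `l = j + 1` the `j`-th other
      refine Fin.cases ?_ (fun j => ?_) l
      · rw [hσ0]
        have e1 : Fin.cast (Nat.add_right_comm s 1 m) (Fin.cast hcast (Fin.natAdd s (Fin.last m))) =
            Fin.natAdd (s + m) (0 : Fin 1) := Fin.ext (by simp)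
        have e2 : Fin.cast hcast (Fin.natAdd s 0) = Fin.castAdd m (Fin.natAdd s (0 : Fin 1)) := Fin.ext (by simp)
        rw [e1, e2, appendParticle_last, Fin.append_left, appendParticle_last]
      · rw [hσs j]
        have e1 : Fin.cast (Nat.add_right_comm s 1 m) (Fin.cast hcast (Fin.natAdd s (Fin.castSucc j))) =
            Fin.castAdd 1 (Fin.natAdd s j) := Fin.ext (by simp)
        have e2 : Fin.cast hcast (Fin.natAdd s j.succ) = Fin.natAdd (s + 1) j := Fin.ext (by simp [Nat.add_right_comm]; omega)
        rw [e1, e2, appendParticle_castAdd, Fin.append_right, Fin.append_right]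
  have hfix : ∀ i : Fin s, σ' (Fin.cast (by omega) (Fin.castAdd (m + 1) i)) = Fin.cast (by omega) (Fin.castAdd (m + 1) i) := by
    intro i
    simp only [hσ', Equiv.trans_apply, finCongr_symm, finCongr_apply]
    have : Fin.cast hcast.symm (Fin.cast (by omega : s + (m + 1) = s + 1 + m) (Fin.castAdd (m + 1) i)) = Fin.castAdd (m + 1) i :=
      Fin.ext rfl
    rw [this, hσl i]
  rw [← key]
  exact hF σ' hfix _

/-- **The `(s+1)`-marginal at an adjoined configuration, partner last**: for `F` symmetric under
the relabellings of the untagged block,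
`f^{(s+1)}(Y, (x, v)) = ∫ F(Y, z_m, (x, v)) dz_m` (the partner read as the LAST particle of the
big configuration, as it arises in the flux computations). [cite: CIPDiluteGases1994, §4.3 (3.5)] -/
theorem nthMarginal_appendParticle_eq_of_restSymmetric [MeasureSpace X] [SigmaFinite (volume : Measure X)]
    {s m : ℕ} {F : Config (s + 1 + m) d X → ℝ}
    (hF : ∀ σ : Equiv.Perm (Fin (s + 1 + m)), (∀ i : Fin s, σ (Fin.cast (by omega) (Fin.castAdd (m + 1) i)) =
      Fin.cast (by omega) (Fin.castAdd (m + 1) i)) → ∀ w : Config (s + 1 + m) d X, F (w ∘ σ) = F w)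
    (Y : Config s d X) (x : X) (v : EuclideanSpace ℝ d) :
    nthMarginal (s + 1 + m) (s + 1) F (appendParticle Y x v) =
      ∫ zm : Config m d X, F (fun k => appendParticle (Fin.append Y zm) x v (Fin.cast (Nat.add_right_comm s 1 m) k)) := by
  rw [nthMarginal_succ_add_apply]
  exact integral_congr_ae (ae_of_all _ fun zm => apply_append_appendParticle_eq_of_restSymmetric hF Y x v zm)

end Marginal

end

end Literature.MathematicalPhysics.KineticTheory
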